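import Summits.QuantumFields.YangMills.Theorems.FluctuationComparisonRegPrIntLSupTailCoverUnionPrintedForm
import HarnessLib

/-!
# `FluctuationComparisonRegPrIntLSupTailCoverUnionPrintedLeaf` — THE LEAF OF THE TAILSUP₁∘ DOOR SUITE: ONE fibrewise per-plaquette tail in print's currency + the per-level floor
# ⇒ TAILSUP₁∘ `WindowOddsSupDepthOneIntCan` verbatim (no regime split, no moment letter, no profile ∕ threshold ∕ weight functions); and the far moment is CLASS-TRIVIAL
# (crux `UnitScaleTilt.FluctuationComparisonRegPrIntL`, stmt-QuantumFields-20520; companion of ✓`…SupTailCoverUnionPrintedForm` (printed-form doors), ✓`…SupTailCoverUnionEventual`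
# (arithmetic), ✓P `…SupTailCoverUnionFibreTail` §1, ✓O `…SupTailCoverUnionTwoRegime` §2)

Cell `ym3-torus` (YM ladder rung R3 = continuum SU(2) Yang–Mills on T³ — a RUNG, NOT the Clay problem: not d = 4, not infinite volume, not a mass gap);
width seat `ym3-torus-px20` (gen 11); helper `--supports stmt-QuantumFields-20520`.  THEOREMS ONLY (0 `def`, 0 `sorry`, default heartbeats).

WHAT.
* §1 `measurableSet_pinned` · `average_le_of_forall_le` · ★`farMoment_le_two_mul_beta` — for EVERY datum `V` (not only a.e.), level pair `J ≤ K` and fine plaquette `p ∈ T_K`: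
  `⨍ β_K(1 − Re tr U(∂p)) d(κ_V.withDensity e^{−β_K A_{¬p}}) ≤ 2·β_K` (`0 ≤ 1 − reTr ≤ ½·dist1² ≤ 2` on `SU(2)`, lit (11) p.258; `κ_V = condLaw dU_K D_{J,K} V` is a probability
  measure, the deleted-weight law is finite by ✓I) · ★`farMomentRow_two_mul_beta` — hence ✓P's (MOMENT) conjunct holds at every level with `M J := 2·β_{J+1}`, i.e. the
  linear slope `cM = 2` of ✓`…PrintedForm`: the (MOMENT) letter is CLASS-TRIVIAL (cell RULING №42 bookkeeping) — it buys something only together with a splitting radius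
  `δ₀² ≤ 8`, where a (TAIL) hand confined to a chart needs it (LEAD w3-20520 g18, 2026-08-30T05:44Z: «the two-regime split earns its keep only for a (TAIL) hand limited
  to a chart radius»).
* §2 ★★★`condGoodOddsDepthOneInt_of_fibreTailPrinted_floor` ∕ ★★★`windowOddsSupDepthOneInt_of_fibreTailPrinted_floor` — THE LEAF: hypothesis = TAILSUP₁∘'s quantifier prefix,
  then (after `F, γ`) constants `C` (any sign), `A : ℕ`, `cT > 0`; (FLOOR) at every level `J` a floor `q > 0` (✓O's row); (TAIL₁) for every `J`, `p ∈ T_{J+1}` and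
  `(dU_{J+1}.map D)`-a.e. datum `V` in the interior window: `∫⁻_{θBal_{J+1} ≤ dist1 U(∂p)} boltzmann dκ_V ≤ ofReal(C·β_{J+1}^A·e^{−cT·p(g_{J+1})²})·∫⁻ boltzmann dκ_V` — ONE
  per-plaquette window-exit fraction of the Boltzmann-tilted conditional Haar law, in print's currency `C·β^A·e^{−c·p(g)²}` ([Balaban1985UV3] (71) p. 273), the fibrewise
  depth-one instance of LINE g22-3's PLAQTAIL∘ — ⇒ ✓K's ⟨COND-ODDS₁∘⟩ ∕ TAILSUP₁∘ verbatim (✓P §1 `pinnedTotal_of_fibrewise` turns (TAIL₁) into ✓`…PrintedForm`'s (ROWS);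
  then `condGoodOddsDepthOneInt_of_pinnedPrinted_floor`).
HONEST SCOPE.  Bookkeeping; (TAIL₁) and the floor are the HYPOTHESIS and are NOT proved — (TAIL₁) is [Balaban1985UV3] (38)–(40) p. 266's conditional small-field estimate per
plaquette (chart + convexity one level deep; no hand yet), the floor is the per-`J` positivity row (cst-p1 g35 ∕ px21 g13's ✓`…SupTailFloorOfWreg` + one `L^∞` letter);
TAILSUP₁∘, MOD₁∘, FAR₁, LFR♯ᶜ∘, S2β, 20520, `YM3TorusSU2` NOT proved; the Yang–Mills mass gap is NOT proved.
HYP-SAT (cell RULING №42).  All letters (`C, A, cT`, the floor `q`) are bound AFTER `F, γ`; (TAIL₁) is per plaquette and RELATIVE to the fibre's own Boltzmann mass (no volume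
factor, so no small-`J` obstruction; px21 g13's reading of ✓`…PrintedForm`, 05:45Z), satisfiable on the literal T³ families at the true quantifier order modulo its analytic
content; the volume ∕ eventuality ∕ super-polynomial bookkeeping is kernel-side (✓`…SupTailCoverUnionEventual` §1).
References: [Balaban1985UV3] (2) p. 256, (7) p. 257, (11) p. 258, (38)–(40) p. 266, (67)–(71) p. 273; [Balaban1985Averaging] (10) p. 19.
-/

noncomputable section

set_option autoImplicit false

open MeasureTheory ProbabilityTheory Filter Topology Set
open scoped ENNReal NNReal BigOperators
open Literature.MathematicalPhysics.QuantumFieldTheory.Balaban1983to89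
open Literature.MathematicalPhysics.QuantumFieldTheory.Balaban1983to89.T3ContinuumYM3Torus
open Literature.MathematicalPhysics.QuantumFieldTheory.Balaban1983to89.T3NestedUnitLaws
open Literature.MathematicalPhysics.QuantumFieldTheory.Balaban1983to89.T3UnitLawDensityEML
open Literature.MathematicalPhysics.QuantumFieldTheory.Balaban1983to89.T3UnitScaleTilt
open Literature.MathematicalPhysics.QuantumFieldTheory.Balaban1983to89.T3TiltDescent
open Literature.MathematicalPhysics.QuantumFieldTheory.Balaban1983to89.Missing
open Literature.MathematicalPhysics.QuantumFieldTheory.Balaban1983to89.T4AveragingDisintegration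
open scoped Literature.MathematicalPhysics.QuantumFieldTheory.Balaban1983to89.T3OrbitAverage
open Summit.QuantumFields.YangMills.Theorems.FluctuationComparisonRegPrIntLWregGlue (heightDensityCan)
open Summit.QuantumFields.YangMills.Theorems.FluctuationComparisonRegPrIntLSupTailCoverUnionTwoRegime (integrable_plaqTerm)
open Summit.QuantumFields.YangMills.Theorems.FluctuationComparisonRegPrIntLSupTailCoverUnionFibreTail (pinnedTotal_of_fibrewise)
open Summit.QuantumFields.YangMills.Theorems.FluctuationComparisonRegPrIntLSupTailCoverUnionPrintedForm (condGoodOddsDepthOneInt_of_pinnedPrinted_floor)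

namespace Summit.QuantumFields.YangMills.Theorems.FluctuationComparisonRegPrIntLSupTailCoverUnionPrintedLeaf

/-! ## §1 Measurability of the pinned event; the far moment is class-trivial -/

section FarMoment

/-- The pinned event `{θ ≤ dist1 U(∂p)}` of one fine plaquette is measurable. [folklore] -/
theorem measurableSet_pinned (F : T3Family) {K : ℕ} (θ : ℝ) (p : Plaq (F.P K) 0) :
    MeasurableSet {U : GaugeField (F.P K) 0 (Matrix.specialUnitaryGroup (Fin 2) ℂ) | θ ≤ dist1 (GaugeField.plaqHol U p)} :=
  measurableSet_le measurable_const (RegularGaugeGroup.measurable_dist1.comp (Missing.measurable_plaqHol p))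

/-- The average of an integrable function bounded above by a constant `c ≥ 0` is `≤ c` (for the zero measure the average is `0 ≤ c`). [folklore] -/
theorem average_le_of_forall_le {X : Type*} [MeasurableSpace X] {μ : Measure X} [IsFiniteMeasure μ] {f : X → ℝ} {c : ℝ} (hc : 0 ≤ c)
    (hf : Integrable f μ) (h : ∀ x, f x ≤ c) : ⨍ x, f x ∂μ ≤ c := by
  by_cases hμ : μ = 0
  · rw [hμ, average_zero_measure]; exact hc
  · obtain ⟨x, hx⟩ := exists_average_le hμ hf
    exact hx.trans (h x)

variable (F : T3Family) {γ : ℝ} {J K : ℕ} (hJK : J ≤ K)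

/-- ★ **THE FAR MOMENT IS CLASS-TRIVIAL**: for `γ ≥ 0`, every level pair `J ≤ K`, fine plaquette `p ∈ T_K` and EVERY window datum `V`, the mean of one plaquette's tilted action
under the deleted-weight conditional Haar law is at most `2·β_K`: `⨍ β_K(1 − Re tr U(∂p)) d(κ_V.withDensity e^{−β_K A_{¬p}}) ≤ 2·β_K` (`1 − reTr ≤ ½·dist1² ≤ 2` on `SU(2)`, lit (11);
`κ_V = condLaw dU_K D_{J,K} V` is a probability measure and the deleted-weight law is finite, ✓I `isFiniteMeasure_withDensity_deleted`). [cite: Balaban1985UV3, (11) p.258 and (67)-(71) p.273] -/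
theorem farMoment_le_two_mul_beta (hγ : 0 ≤ γ) (p : Plaq (F.P K) 0) (V : GaugeField (F.P J) 0 (Matrix.specialUnitaryGroup (Fin 2) ℂ)) :
    ⨍ U, (F.scheme ℰp γ).β K * (1 - reTr (GaugeField.plaqHol U p))
      ∂((condLaw (fieldMeasure (F.P K) 0 (Matrix.specialUnitaryGroup (Fin 2) ℂ)) (descendTo F ℰp J K hJK) V).withDensity fun U =>
        ENNReal.ofReal (Real.exp (-((F.scheme ℰp γ).β K * (wilsonAction4 U - (1 - reTr (GaugeField.plaqHol U p))))))) ≤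
      2 * (F.scheme ℰp γ).β K := by
  have hβ : 0 ≤ (F.scheme ℰp γ).β K := F.scheme_β_nonneg ℰp hγ K
  set κ := condLaw (fieldMeasure (F.P K) 0 (Matrix.specialUnitaryGroup (Fin 2) ℂ)) (descendTo F ℰp J K hJK) V with hκ
  haveI := FluctuationComparisonRegPrIntLTailSupOneDeletedTermJensen.isFiniteMeasure_withDensity_deleted κ hβ p
  refine average_le_of_forall_le (by positivity) (integrable_plaqTerm _ _ p) fun U => ?_
  have h2 : 1 - reTr (GaugeField.plaqHol U p) ≤ 2 := by
    have hd := T4PairDerivBridge.dist1_le_two_specialUnitaryGroup (GaugeField.plaqHol U p)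
    have hd0 := GaugeGroup.dist1_nonneg (GaugeField.plaqHol U p)
    have := B10Eq5RegularAction.one_sub_reTr_le_specialUnitaryGroup (GaugeField.plaqHol U p)
    nlinarith
  calc (F.scheme ℰp γ).β K * (1 - reTr (GaugeField.plaqHol U p)) ≤ (F.scheme ℰp γ).β K * 2 := mul_le_mul_of_nonneg_left h2 hβ
    _ = 2 * (F.scheme ℰp γ).β K := mul_comm _ _

/-- ★ **✓P's (MOMENT) CONJUNCT WITH `M J := 2·β_{J+1}`** (the linear slope `cM = 2` of ✓`…PrintedForm`): for `γ ≥ 0`, at every level `J` and fine plaquette `p ∈ T_{J+1}`, for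
a.e. (indeed every) datum `V`, interior-window or not, `⨍ β_{J+1}(1 − Re tr U(∂p)) d(κ_V.withDensity e^{−β_{J+1}A_{¬p}}) ≤ 2·β_{J+1}`.  With `cM = 2` the splitting radius must satisfy
`δ₀² > 8`, where `{δ₀ ≤ dist1}` is empty on `SU(2)` — so the content of the suite lives in the (TAIL) letter alone (§2). [cite: Balaban1985UV3, (11) p.258 and (67)-(71) p.273] -/
theorem farMomentRow_two_mul_beta (hγ : 0 ≤ γ) (θI : ℕ → ℝ) (J : ℕ) (p : Plaq (F.P (J + 1)) 0) :
    ∀ᵐ V ∂((fieldMeasure (F.P (J + 1)) 0 (Matrix.specialUnitaryGroup (Fin 2) ℂ)).map (descendTo F ℰp J (J + 1) (Nat.le_succ J))),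
      PlaqSmall (θI J) V →
        ⨍ U, (F.scheme ℰp γ).β (J + 1) * (1 - reTr (GaugeField.plaqHol U p))
          ∂((condLaw (fieldMeasure (F.P (J + 1)) 0 (Matrix.specialUnitaryGroup (Fin 2) ℂ)) (descendTo F ℰp J (J + 1) (Nat.le_succ J)) V).withDensity
            fun U => ENNReal.ofReal (Real.exp (-((F.scheme ℰp γ).β (J + 1) *
              (wilsonAction4 U - (1 - reTr (GaugeField.plaqHol U p))))))) ≤ 2 * (F.scheme ℰp γ).β (J + 1) :=
  Eventually.of_forall fun V _ => farMoment_le_two_mul_beta F (Nat.le_succ J) hγ p V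

end FarMoment

/-! ## §2 The leaf: one fibrewise per-plaquette tail in print's currency + the floor ⇒ ⟨COND-ODDS₁∘⟩ ⇒ TAILSUP₁∘ -/

section Leaf

/-- ★★★ **THE LEAF: ⟨FIBRE-TAIL-PRINTED₁ + FLOOR⟩ ⇒ ✓K's ⟨COND-ODDS₁∘⟩.**  Hypothesis (TAILSUP₁∘'s quantifier prefix, then; all letters after `F, γ`): constants `C` (any sign),
`A : ℕ`, `cT > 0`; (FLOOR) at EVERY level `J` a floor `q > 0` with `ofReal(q)·Gibbs_{J+1}(D⁻¹B) ≤ Gibbs_{J+1}(D⁻¹B ∩ histGood)` for measurable `B` in the interior window;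
(TAIL₁) for every `J`, fine plaquette `p ∈ T_{J+1}`, for `(dU_{J+1}.map D)`-a.e. datum `V` in the INTERIOR window (`κ_V = condLaw dU_{J+1} D_{J,J+1} V`):
`∫⁻_{θBal L γ b₀ p₀ (J+1) ≤ dist1 U(∂p)} boltzmann dκ_V ≤ ofReal(C·β_{J+1}^A·e^{−cT·pFun b₀ p₀ (√(γL^{−(J+1)}))²})·∫⁻ boltzmann dκ_V` — ONE regime, no splitting radius, no
moment.  ✓P §1 `pinnedTotal_of_fibrewise` (at the interior profile `c·b₀`) turns (TAIL₁) into ✓`…PrintedForm`'s total-mass (ROWS); then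
`condGoodOddsDepthOneInt_of_pinnedPrinted_floor` (profile, threshold `J₀(F.m, …)`, weights produced there). [cite: Balaban1985UV3, (2) p.256, (7) p.257, (38)-(40) p.266 and (71) p.273] -/
theorem condGoodOddsDepthOneInt_of_fibreTailPrinted_floor
    (h : ∀ (L : ℕ), ∃ c₀ : ℝ, 0 < c₀ ∧ c₀ ≤ 1 ∧ ∀ (c : ℝ), 0 < c → c ≤ c₀ → ∃ pS : ℝ, ∀ (b₀ p₀ : ℝ), 0 < b₀ → pS ≤ p₀ → 0 < p₀ →
      ∃ γ₁ : ℝ, 0 < γ₁ ∧ ∀ (F : T3Family) (γ : ℝ), F.L = L → 0 < γ → γ ≤ γ₁ →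
        ∃ (C : ℝ) (A : ℕ) (cT : ℝ), 0 < cT ∧
          (∀ J : ℕ, ∃ q : ℝ, 0 < q ∧ ∀ (B : Set (GaugeField (F.P J) 0 (Matrix.specialUnitaryGroup (Fin 2) ℂ))), MeasurableSet B →
            B ⊆ {U | PlaqSmall (θBal F.L γ (c * b₀) p₀ J) U} →
            ENNReal.ofReal q * gibbsK F ℰp γ (J + 1) (descendTo F ℰp J (J + 1) (Nat.le_succ J) ⁻¹' B) ≤
              gibbsK F ℰp γ (J + 1) (descendTo F ℰp J (J + 1) (Nat.le_succ J) ⁻¹' B ∩ histGood F ℰp (θBal F.L γ b₀ p₀) (J + 1) J)) ∧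
          ∀ (J : ℕ) (p : Plaq (F.P (J + 1)) 0),
            ∀ᵐ V ∂((fieldMeasure (F.P (J + 1)) 0 (Matrix.specialUnitaryGroup (Fin 2) ℂ)).map (descendTo F ℰp J (J + 1) (Nat.le_succ J))),
              PlaqSmall (θBal F.L γ (c * b₀) p₀ J) V →
                ∫⁻ U in {U | θBal F.L γ b₀ p₀ (J + 1) ≤ dist1 (GaugeField.plaqHol U p)},
                    ENNReal.ofReal (boltzmann (F.P (J + 1)) ((F.scheme ℰp γ).β (J + 1)) U)
                    ∂(condLaw (fieldMeasure (F.P (J + 1)) 0 (Matrix.specialUnitaryGroup (Fin 2) ℂ)) (descendTo F ℰp J (J + 1) (Nat.le_succ J)) V) ≤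
                  ENNReal.ofReal (C * (F.scheme ℰp γ).β (J + 1) ^ A *
                      Real.exp (-(cT * B10.pFun b₀ p₀ (Real.sqrt (γ * ((F.L : ℝ)⁻¹) ^ (J + 1))) ^ 2))) *
                    ∫⁻ U, ENNReal.ofReal (boltzmann (F.P (J + 1)) ((F.scheme ℰp γ).β (J + 1)) U)
                      ∂(condLaw (fieldMeasure (F.P (J + 1)) 0 (Matrix.specialUnitaryGroup (Fin 2) ℂ)) (descendTo F ℰp J (J + 1) (Nat.le_succ J)) V)) :
    ∀ (L : ℕ), ∃ c₀ : ℝ, 0 < c₀ ∧ c₀ ≤ 1 ∧ ∀ (c : ℝ), 0 < c → c ≤ c₀ → ∃ pS : ℝ, ∀ (b₀ p₀ : ℝ), 0 < b₀ → pS ≤ p₀ → 0 < p₀ →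
      ∃ γ₁ : ℝ, 0 < γ₁ ∧ ∀ (F : T3Family) (γ : ℝ), F.L = L → 0 < γ → γ ≤ γ₁ →
        ∃ τ : ℕ → ℝ, (∀ J, 0 ≤ τ J) ∧ (∀ a : ℕ, Tendsto (fun J : ℕ => ((J : ℝ) + 1) ^ a * τ J) atTop (𝓝 0)) ∧
          ∀ (J : ℕ) (B : Set (GaugeField (F.P J) 0 (Matrix.specialUnitaryGroup (Fin 2) ℂ))), MeasurableSet B →
            B ⊆ {U | PlaqSmall (θBal F.L γ (c * b₀) p₀ J) U} →
            gibbsK F ℰp γ (J + 1) (descendTo F ℰp J (J + 1) (Nat.le_succ J) ⁻¹' B) ≤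
              ENNReal.ofReal (Real.exp (τ J)) *
                gibbsK F ℰp γ (J + 1) (descendTo F ℰp J (J + 1) (Nat.le_succ J) ⁻¹' B ∩ histGood F ℰp (θBal F.L γ b₀ p₀) (J + 1) J) := by
  refine condGoodOddsDepthOneInt_of_pinnedPrinted_floor fun L => ?_
  obtain ⟨c₀, hc₀, hc₀1, hc⟩ := h L
  refine ⟨c₀, hc₀, hc₀1, fun c hcpos hcle => ?_⟩
  obtain ⟨pS, hpS⟩ := hc c hcpos hcle
  refine ⟨pS, fun b₀ p₀ hb₀ hpS' hp₀ => ?_⟩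
  obtain ⟨γ₁, hγ₁, hγ₁F⟩ := hpS b₀ p₀ hb₀ hpS' hp₀
  refine ⟨γ₁, hγ₁, fun F γ hFL hγ hγle => ?_⟩
  obtain ⟨C, A, cT, hcT, hfloor, htail⟩ := hγ₁F F γ hFL hγ hγle
  exact ⟨C, A, cT, hcT, hfloor, fun J p B hB hBW =>
    pinnedTotal_of_fibrewise F (c * b₀) p₀ (Nat.le_succ J) (measurableSet_pinned F (θBal F.L γ b₀ p₀ (J + 1)) p) (htail J p) hB hBW⟩

/-- ★★★ **THE LEAF ⇒ TAILSUP₁∘** (LINE g21-2 v1.4's interior row `RunPairOrgan.OneLoop.WindowOddsSupDepthOneIntCan`, text verbatim): ⟨FIBRE-TAIL-PRINTED₁ + FLOOR⟩, then ✓K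
`windowOddsSupDepthOneIntCan_of_condGoodOddsDepthOneInt`.  AFTER THIS FILE THE HAND'S RESIDUE FOR TAILSUP₁∘ IS: ONE per-plaquette window-exit fraction of the Boltzmann-tilted
conditional Haar law one level deep, in print's currency (chart + convexity), and the per-level FLOOR.  HONEST SCOPE: both are the HYPOTHESIS; nothing upstream is proved.
[cite: Balaban1985UV3, (2) p.256, (7) p.257, (38)-(40) p.266 and (71) p.273] -/
theorem windowOddsSupDepthOneInt_of_fibreTailPrinted_floor
    (h : ∀ (L : ℕ), ∃ c₀ : ℝ, 0 < c₀ ∧ c₀ ≤ 1 ∧ ∀ (c : ℝ), 0 < c → c ≤ c₀ → ∃ pS : ℝ, ∀ (b₀ p₀ : ℝ), 0 < b₀ → pS ≤ p₀ → 0 < p₀ →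
      ∃ γ₁ : ℝ, 0 < γ₁ ∧ ∀ (F : T3Family) (γ : ℝ), F.L = L → 0 < γ → γ ≤ γ₁ →
        ∃ (C : ℝ) (A : ℕ) (cT : ℝ), 0 < cT ∧
          (∀ J : ℕ, ∃ q : ℝ, 0 < q ∧ ∀ (B : Set (GaugeField (F.P J) 0 (Matrix.specialUnitaryGroup (Fin 2) ℂ))), MeasurableSet B →
            B ⊆ {U | PlaqSmall (θBal F.L γ (c * b₀) p₀ J) U} →
            ENNReal.ofReal q * gibbsK F ℰp γ (J + 1) (descendTo F ℰp J (J + 1) (Nat.le_succ J) ⁻¹' B) ≤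
              gibbsK F ℰp γ (J + 1) (descendTo F ℰp J (J + 1) (Nat.le_succ J) ⁻¹' B ∩ histGood F ℰp (θBal F.L γ b₀ p₀) (J + 1) J)) ∧
          ∀ (J : ℕ) (p : Plaq (F.P (J + 1)) 0),
            ∀ᵐ V ∂((fieldMeasure (F.P (J + 1)) 0 (Matrix.specialUnitaryGroup (Fin 2) ℂ)).map (descendTo F ℰp J (J + 1) (Nat.le_succ J))),
              PlaqSmall (θBal F.L γ (c * b₀) p₀ J) V →
                ∫⁻ U in {U | θBal F.L γ b₀ p₀ (J + 1) ≤ dist1 (GaugeField.plaqHol U p)},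
                    ENNReal.ofReal (boltzmann (F.P (J + 1)) ((F.scheme ℰp γ).β (J + 1)) U)
                    ∂(condLaw (fieldMeasure (F.P (J + 1)) 0 (Matrix.specialUnitaryGroup (Fin 2) ℂ)) (descendTo F ℰp J (J + 1) (Nat.le_succ J)) V) ≤
                  ENNReal.ofReal (C * (F.scheme ℰp γ).β (J + 1) ^ A *
                      Real.exp (-(cT * B10.pFun b₀ p₀ (Real.sqrt (γ * ((F.L : ℝ)⁻¹) ^ (J + 1))) ^ 2))) *
                    ∫⁻ U, ENNReal.ofReal (boltzmann (F.P (J + 1)) ((F.scheme ℰp γ).β (J + 1)) U)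
                      ∂(condLaw (fieldMeasure (F.P (J + 1)) 0 (Matrix.specialUnitaryGroup (Fin 2) ℂ)) (descendTo F ℰp J (J + 1) (Nat.le_succ J)) V)) :
    ∀ (L : ℕ), ∃ c₀ : ℝ, 0 < c₀ ∧ c₀ ≤ 1 ∧ ∀ (c : ℝ), 0 < c → c ≤ c₀ → ∃ pS : ℝ, ∀ (b₀ p₀ : ℝ), 0 < b₀ → pS ≤ p₀ → 0 < p₀ →
    ∃ γ₁ : ℝ, 0 < γ₁ ∧ ∀ (F : T3Family) (γ : ℝ), F.L = L → 0 < γ → γ ≤ γ₁ →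
      ∃ τ : ℕ → ℝ, (∀ J, 0 ≤ τ J) ∧ (∀ a : ℕ, Tendsto (fun J : ℕ => ((J : ℝ) + 1) ^ a * τ J) atTop (𝓝 0)) ∧
        ∀ (ν : ℕ → (j : ℕ) → Measure (GaugeField (F.P j) 0 (Matrix.specialUnitaryGroup (Fin 2) ℂ))),
          (∀ K, ν K K = T4GenFunBounds.gibbsMeasure (F.P K) ((F.scheme ℰp γ).β K)) →
          (∀ K j, j < K → ν K j = Measure.map (descend F ℰp j) (ν K (j + 1))) →
          ∀ (J : ℕ) (ρ : GaugeField (F.P J) 0 (Matrix.specialUnitaryGroup (Fin 2) ℂ) → ℝ),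
            (∀ U, PlaqSmall (θBal F.L γ (c * b₀) p₀ J) U → 0 < ρ U) →
            ν (J + 1) J = (fieldMeasure _ _ _).withDensity (fun U => ENNReal.ofReal (ρ U)) →
            ContinuousOn ρ {U | PlaqSmall (θBal F.L γ (c * b₀) p₀ J) U} →
            (∀ U : GaugeField (F.P J) 0 (Matrix.specialUnitaryGroup (Fin 2) ℂ), PlaqSmall (θBal F.L γ (c * b₀) p₀ J) U →
                0 < heightDensityCan F γ (Nat.le_succ J) (histGood F ℰp (θBal F.L γ b₀ p₀) (J + 1) J) U) →
            ∃ a₀ : ℝ, ∀ U : GaugeField (F.P J) 0 (Matrix.specialUnitaryGroup (Fin 2) ℂ), PlaqSmall (θBal F.L γ (c * b₀) p₀ J) U →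
              0 ≤ Real.log (ρ U) - a₀ - Real.log (heightDensityCan F γ (Nat.le_succ J) (histGood F ℰp (θBal F.L γ b₀ p₀) (J + 1) J) U) ∧
              Real.log (ρ U) - a₀ - Real.log (heightDensityCan F γ (Nat.le_succ J) (histGood F ℰp (θBal F.L γ b₀ p₀) (J + 1) J) U) ≤ τ J :=
  FluctuationComparisonRegPrIntLSupTailReductionInt.windowOddsSupDepthOneIntCan_of_condGoodOddsDepthOneInt
    (condGoodOddsDepthOneInt_of_fibreTailPrinted_floor h)

end Leaf

end Summit.QuantumFields.YangMills.Theorems.FluctuationComparisonRegPrIntLSupTailCoverUnionPrintedLeaf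

end
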